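import Summits.Ventures.CertifiedArithmetic.LowPrec.RoundToOdd
import Summits.Ventures.CertifiedArithmetic.LowPrec.GemmDeficit

/-!
# Free moves of the accumulator walk: gemm.tex Lemma D (ii)/(iii) (ties, parity)

HONEST FRAMING (venture CertifiedArithmetic / cell `pub-lowprec`): certified error envelopes and
provably optimal rounding/accumulation schemes for low-precision formats under stated cost models;
every table by two implementations; no hardware or vendor claims.

Setting of `paper/gemm.tex` §Regimes ("Walks, gains, deficits"): a sequential accumulation in a
format `α` under the cell's saturating round-to-nearest-even is read as a walk on the values of
`α`; a STEP from the vertex `v` (a datum) with letter `p` goes to `v' = fl(v + p)`, with GAIN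
`δ = v' - (v + p)` and DEFICIT `d = |p| - δ`; it is a MOVE if `v' ≠ v` (as values) and a FREE MOVE
if moreover `d = 0`.

LEMMA D [gemm.tex, Lemma `l:deficit`]: clause (i) (`δ ≤ |p|`, `d ≥ 0`) is the gemm seat's
`GemmDeficit.lean` (`gain_step_le_abs`); this file adds clauses (ii) and (iii) for EVERY format
with `m ≥ 1` and every rational letter, with no range hypothesis (saturation included):
* (ii) `free_move`: a free move has `p > 0`, `v + p` is the midpoint of `v` and `v' = v + 2p`
  (a tie resolved AWAY from `v`), `v'` has an EVEN and `v` an ODD trailing significand — the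
  "adjacent-representable parity lemma" asked for in the gemm seat's hand-off (T3), supplied by
  `RoundToOdd.not_two_dvd_man_and_succ` (a value and its successor are never both even) after
  showing that `v'` is the successor of `v` (resp. `-v` the successor of `-v'`; a free move never
  crosses `0`);
* (iii) `gain_lt_abs_of_even` (no free move starts at a vertex with even significand),
  `no_consecutive_free_moves`, `gain_lt_abs_of_zero` (no free move starts at `0`).
These are the structural facts behind the graph constants `Φ`, `β̄` and Theorem `t:terminal`
(which remain certificate-backed); (i) is what makes Dijkstra applicable (`d ≥ 0`), (iii) what
makes the pairing in Lemma `l:moving` possible.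
-/

namespace Literature.ComputerArithmetic.FloatingPoint

namespace MiniFloat

open Format

variable {α : Format}

/-! ### (ii) free moves: ties away from the vertex, parity -/

/-- A datum of value `0` has trailing significand `0`. [folklore] -/
theorem man_eq_zero_of_toRat_eq_zero {v : MiniFloat α} (hv : v.toRat = 0) : v.man = 0 := by
  have hq := α.quantum_pos
  have h0 : v.scaledMag = 0 := by
    have h1 : (v.toInt : ℚ) = 0 := by
      rw [toRat_eq_toInt_mul] at hv
      rcases mul_eq_zero.mp hv with h | h
      · exact h
      · exact absurd h hq.ne'
    have h2 : v.toInt = 0 := by exact_mod_cast h1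
    have h3 := natAbs_toInt v
    rw [h2] at h3; simpa using h3.symm
  unfold scaledMag Format.scaled at h0
  split at h0
  · exact h0
  · have : 0 < 2 ^ α.manBits + v.man := by positivity
    have : 0 < 2 ^ (v.expCode - 1) := by positivity
    simp_all

/-- No value of `α` lies strictly closer to `x` than `fl(x)`; in particular no value lies
strictly inside the open interval of radius `|x - fl x|` around `x`. [folklore] -/
theorem not_lt_dist_roundNE (x : ℚ) (y : MiniFloat α) :
    ¬ |x - y.toRat| < |x - (roundNE α x).toRat| :=
  not_lt.mpr (roundNE_nearest x y)

/-- LEMMA D (ii): a FREE MOVE — a step `v ↦ v' = fl(v + p)` with `v' ≠ v` (as values) and gain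
`δ = |p|` — has `p > 0` and `v' = v + 2p` (the exact point `v + p` is the midpoint of `v` and `v'`,
the tie resolved away from `v`), `v'` has an EVEN trailing significand and `v` an ODD one
(`m ≥ 1`; every format, saturation included; `v'` is the successor of `v`, and a value and its
successor are never both even). [cell, gemm.tex Lemma l:deficit (ii)] -/
theorem free_move (hm : 1 ≤ α.manBits) (v : MiniFloat α) (p : ℚ)
    (hmove : (roundNE α (v.toRat + p)).toRat ≠ v.toRat)
    (hfree : (roundNE α (v.toRat + p)).toRat - (v.toRat + p) = |p|) :
    0 < p ∧ (roundNE α (v.toRat + p)).toRat = v.toRat + 2 * p ∧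
      2 ∣ (roundNE α (v.toRat + p)).man ∧ ¬ 2 ∣ v.man := by
  set x := v.toRat + p with hx
  set v' := roundNE α x with hv'
  have hq := α.quantum_pos
  have hfree' : v'.toRat = x + |p| := by linarith [hfree]
  -- `p > 0` (otherwise the gain `|p| = -p` means `v' = v`)
  have hp : 0 < p := by
    by_contra hle
    have hle : p ≤ 0 := not_lt.mp hle
    exact hmove (by rw [hfree', abs_of_nonpos hle, hx]; ring)
  have hval : v'.toRat = v.toRat + 2 * p := by
    rw [hfree', abs_of_pos hp, hx]; ring
  -- the tie: `v` and `v'` are equally near `x`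
  have htie : |x - v.toRat| = |x - v'.toRat| := by
    rw [hval, hx, show v.toRat + p - v.toRat = p by ring,
      show v.toRat + p - (v.toRat + 2 * p) = -p by ring, abs_neg]
  have heven : 2 ∣ v'.man := roundNE_man_even_of_tie hm htie (Ne.symm hmove)
  refine ⟨hp, hval, heven, ?_⟩
  -- `v'` is the successor of `v` (no value strictly between them: it would beat the tie)
  have hbetween : ∀ y : MiniFloat α, ¬ (v.toRat < y.toRat ∧ y.toRat < v'.toRat) := by
    rintro y ⟨h1, h2⟩
    apply not_lt_dist_roundNE x y
    rw [← hv', ← htie, hx, show v.toRat + p - v.toRat = p by ring, abs_of_pos hp]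
    rw [hval] at h2
    rw [abs_lt]; constructor <;> linarith
  intro hvev
  rcases le_or_gt 0 v.toRat with hv0 | hvneg
  · -- `v ≥ 0`: `v' = v + ulp(v)`
    have hlt : v.toRat < v'.toRat := by rw [hval]; linarith
    obtain ⟨u, hu⟩ := exists_toRat_eq_add_ulp hv0 hlt
    have hle := add_ulp_le_of_lt hv0 hlt
    have hG : (0:ℚ) < 2 ^ (v.expCode - 1) * α.quantum := by positivity
    have hsucc : v'.toRat = v.toRat + 2 ^ (v.expCode - 1) * α.quantum := by
      rcases eq_or_lt_of_le hle with h | h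
      · exact h.symm
      · exact absurd ⟨by rw [hu]; linarith, by rw [hu]; exact h⟩ (hbetween u)
    exact not_two_dvd_man_and_succ hm hv0 hsucc ⟨hvev, heven⟩
  · -- `v < 0`: then `v' ≤ 0` (a free move never crosses `0`), and `-v` is the successor of `-v'`
    have hv'le : v'.toRat ≤ 0 := by
      by_contra hpos
      have hpos : 0 < v'.toRat := not_le.mp hpos
      exact hbetween (MiniFloat.zero α) ⟨by rw [toRat_zero]; exact hvneg, by rw [toRat_zero]; exact hpos⟩
    have hw0 : 0 ≤ (flipSign v').toRat := by rw [toRat_flipSign]; linarith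
    have hlt : (flipSign v').toRat < (flipSign v).toRat := by
      rw [toRat_flipSign, toRat_flipSign, hval]; linarith
    obtain ⟨u, hu⟩ := exists_toRat_eq_add_ulp hw0 hlt
    have hle := add_ulp_le_of_lt hw0 hlt
    have hG' : (0:ℚ) < 2 ^ ((flipSign v').expCode - 1) * α.quantum := by positivity
    have hfv : (flipSign v).toRat = -v.toRat := toRat_flipSign v
    have hfv' : (flipSign v').toRat = -v'.toRat := toRat_flipSign v'
    have hsucc : (flipSign v).toRat = (flipSign v').toRat + 2 ^ ((flipSign v').expCode - 1) * α.quantum := by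
      rcases eq_or_lt_of_le hle with h | h
      · exact h.symm
      · exfalso
        refine hbetween (flipSign u) ⟨?_, ?_⟩
        · rw [toRat_flipSign, hu]; linarith
        · rw [toRat_flipSign, hu]; linarith
    have h := not_two_dvd_man_and_succ hm hw0 hsucc
    exact h ⟨heven, hvev⟩

/-! ### (iii) consequences: where free moves cannot start -/

/-- LEMMA D (iii): no free move starts at a vertex with EVEN trailing significand — from such a
vertex every move has gain `< |p|` (positive deficit). [cell, gemm.tex Lemma l:deficit (iii)] -/
theorem gain_lt_abs_of_even (hm : 1 ≤ α.manBits) (v : MiniFloat α) (p : ℚ) (hv : 2 ∣ v.man)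
    (hmove : (roundNE α (v.toRat + p)).toRat ≠ v.toRat) :
    (roundNE α (v.toRat + p)).toRat - (v.toRat + p) < |p| := by
  rcases lt_or_eq_of_le (gain_step_le_abs v p) with h | h
  · exact h
  · exact absurd hv (free_move hm v p hmove h).2.2.2

/-- LEMMA D (iii): two consecutive free moves are impossible — after a free move `v ↦ v'` the
next move (from `v'`, any letter `q`) has gain `< |q|`. [cell, gemm.tex Lemma l:deficit (iii)] -/
theorem no_consecutive_free_moves (hm : 1 ≤ α.manBits) (v : MiniFloat α) (p q : ℚ)
    (hmove : (roundNE α (v.toRat + p)).toRat ≠ v.toRat)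
    (hfree : (roundNE α (v.toRat + p)).toRat - (v.toRat + p) = |p|)
    (hmove' : (roundNE α ((roundNE α (v.toRat + p)).toRat + q)).toRat ≠ (roundNE α (v.toRat + p)).toRat) :
    (roundNE α ((roundNE α (v.toRat + p)).toRat + q)).toRat - ((roundNE α (v.toRat + p)).toRat + q)
      < |q| :=
  gain_lt_abs_of_even hm _ q (free_move hm v p hmove hfree).2.2.1 hmove'

/-- LEMMA D (iii): no free move starts at `0` (both zeros have significand `0`).
[cell, gemm.tex Lemma l:deficit (iii)] -/
theorem gain_lt_abs_of_zero (hm : 1 ≤ α.manBits) (v : MiniFloat α) (hv : v.toRat = 0) (p : ℚ)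
    (hmove : (roundNE α (v.toRat + p)).toRat ≠ v.toRat) :
    (roundNE α (v.toRat + p)).toRat - (v.toRat + p) < |p| :=
  gain_lt_abs_of_even hm v p (by rw [man_eq_zero_of_toRat_eq_zero hv]; exact dvd_zero 2) hmove

/-- Absorptions classified (the paper's gainful / null / lossy cases): if `fl(v + p) = v` then the
gain is `-p` and the deficit `|p| + p` — `0` for `p < 0` (gainful), `0` for `p = 0` (null), `2p`
for `p > 0` (lossy). [cell, gemm.tex §Regimes] -/
theorem absorption_gain (v : MiniFloat α) (p : ℚ) (habs : (roundNE α (v.toRat + p)).toRat = v.toRat) :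
    (roundNE α (v.toRat + p)).toRat - (v.toRat + p) = -p ∧
      |p| - ((roundNE α (v.toRat + p)).toRat - (v.toRat + p)) = |p| + p := by
  rw [habs]; constructor <;> ring

/-- Kernel illustration (bfloat16, `u = 2⁻⁸`): from the ODD vertex `72¼·4 = 289` quarter-units…
concretely, the step `255/2 ↦ fl(255/2 + 1/4) = 128` is a free move (`255/2` has odd significand
`255`, gain `¼ = |p|`, end `128` even), while from the even vertex `72` the letter `¼` is absorbed
(`fl(72 + ¼) = 72`, the stationary tie chain of `GemmTieChainFamilies`). -/
example :
    (roundNE Format.BFloat16 ((255 : ℚ) / 2 + 1 / 4)).toRat = 128 ∧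
    (roundNE Format.BFloat16 ((255 : ℚ) / 2 + 1 / 4)).toRat - (255 / 2 + 1 / 4) = |(1 : ℚ) / 4| ∧
    (roundNE Format.BFloat16 ((72 : ℚ) + 1 / 4)).toRat = 72 := by
  refine ⟨by decide +kernel, ?_, by decide +kernel⟩
  rw [show (roundNE Format.BFloat16 ((255 : ℚ) / 2 + 1 / 4)).toRat = 128 by decide +kernel]
  norm_num

end MiniFloat

end Literature.ComputerArithmetic.FloatingPoint
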